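import Summits.RiemannHypothesis.RiemannHypothesis.Theses.LiRephasingBarrier
import Summits.RiemannHypothesis.RiemannHypothesis.Theorems.Splittings.LiRephasingMovingCutPrelim
import HarnessLib

/-!
# Route LiRephasingBarrier (L5 «LI REPHASING GAIN BUDGET») — crux `ScalePL` closed BY NAME (RH-FREE)

Item stmt-RiemannHypothesis-22318 is, verbatim, the ∀-closure of the tree theorem
`Summit.RiemannHypothesis.RiemannHypothesis.Theorems.Splittings.LiRephasingMovingCutPrelim.exists_scale_PL`
(lane (xi-q) carve Q5, existence of a scale `(J, N)` with the moving cut). One-line closer.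
RH-free barrier-side record (B18); no summit is proved by this; nothing here bears on the truth of RH.
-/

-- D-0017: `Summit.RiemannHypothesis.RiemannHypothesis.…` duplicates the namespace BY DESIGN (single-problem summit).
set_option linter.dupNamespace false

namespace Summit.RiemannHypothesis.RiemannHypothesis.Theorems.LiRephasingBarrier

/-- **Crux `ScalePL` (item stmt-RiemannHypothesis-22318) holds** — it is the tree theorem
`Splittings.LiRephasingMovingCutPrelim.exists_scale_PL` (scale with the Pólya–Landau cut), cited by
name. RH-free. -/
theorem scalePL_proof :
    Summit.RiemannHypothesis.RiemannHypothesis.Theses.LiRephasingBarrier.ScalePL :=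
  fun _T hT _m hm K ↦ Splittings.LiRephasingMovingCutPrelim.exists_scale_PL hT hm K

end Summit.RiemannHypothesis.RiemannHypothesis.Theorems.LiRephasingBarrier
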